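import Literature.Analysis.InnerProduct.HilbertComplexMinMax
import Literature.Analysis.InnerProduct.HilbertComplexEigenspaceSupersymmetry
import HarnessLib

/-!
# Eigenvalue comparison under maps of Hilbert complexes (Brüning–Lesch 1992, Lemma 2.17 (2.52)): the counting
# functions of `T*T` and `T′*T′`, of `SS*` and `S′S′*`, for isomorphic discrete complexes satisfy `N(λ) ≤ N′(Cλ)`

Layer `Literature/Analysis/InnerProduct`, namespace `Literature.Analysis.InnerProduct`; sequel BY NAME of
`HilbertComplexMinMax.lean` (the max–min layer for the Laplacian of a discrete complex: `finrank_span_eigenvectors_lt`,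
`span_eigenvectors_le_laplacian_domain`, `inner_eigenvector_eq_zero_of_mem_span`, `re_inner_laplacian_lt_mul_norm_sq`,
`mul_norm_sq_le_form_of_mem_orthogonal_span`), `HilbertComplexLaplacian.lean` (`re_inner_laplacian_self`,
`laplacian_domain_le_domain`, `laplacian_domain_le_adjoint_domain`) and `HilbertComplexEigenspaceSupersymmetry.lean`
(the bridges `laplacian_domain_iff_of_adjointCompSelf` / `laplacian_apply_of_adjointCompSelf` /
`laplacian_domain_iff_of_selfCompAdjoint` / `laplacian_apply_of_selfCompAdjoint` presenting `T*T` and `SS*` as Laplacians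
of windows with a zero end). Lane `lit-hodgefound` (Track 2 foundations library), prover seat `lit-hodgefound-p06`
(generation 34), self-proposed row g34-#7. THEOREMS ONLY (no definition, no instance, no named fact). Maps of complexes as
in `HilbertComplexMaps.lean` (row g34-#3): bounded `g_E, g_F, …` with `hgT : ∀ w ∈ D(T), g_E w ∈ D(T′) ∧ T′(g_E w) =
g_F(Tw)`; the Laplacians are hypothesis-parametrised (`hdom`/`hval` for `□ = TT* + S*S` on the middle space,
`hdomA`/`hvalA` for `T*T`, `hdomC`/`hvalC` for `SS*`), discreteness is a Hilbert basis of eigenvectors `heig` with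
`μᵢ → ∞` (`htend`), on BOTH complexes.

## Source, verbatim

J. Brüning, M. Lesch, *Hilbert complexes*, J. Funct. Anal. 108 (1992), §2 pp. 103–104 (held text
`paper:doi-10-1016-0022-1236-92-90147-b`, p0016–p0017):

"It is clear that, for a given Hilbert complex `(𝒟, D)`, the spectral properties of `Δ` provide very interesting
invariants. Since in practice complex isomorphisms are a rather flexible tool it is useful to investigate how spectral
properties of `Δ` transform. We present here only a rough comparison result for the Laplacians in case of a discrete
spectrum … consider a complex isomorphism `g : (𝒟, D) → (𝒟′, D′)` … Then observe that `h := (g⁻¹)* : (𝒟*, D*) →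
(𝒟′*, D′*)` is also a complex isomorphism. … Now the bilinear form generated by `Δ_i` on `𝒟_i ∩ 𝒟*_{i−1}` is simply
`C^{(i)}(u | u) := ‖D_i u‖² + ‖D*_{i−1} u‖²` … it follows that `C′(k_i(u), k_i(u)) = … = ‖g_{i+1} D_i u₂‖² +
‖(g_{i−1}⁻¹)* D*_{i−1} u₁‖² ≤ C‖u‖²_{…}` (2.51) since `g` is a complex isomorphism. This situation calls for an application
of the max-min-principle for which we have to assume, however, that `Δ` has a discrete spectrum … LEMMA 2.17.
Discreteness is invariant under complex isomorphisms. More precisely, if `(𝒟, D)` is a discrete Hilbert complex and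
`g : (𝒟, D) → (𝒟′, D′)` is a complex isomorphism then we have for the eigenvalues `λₙ`, `λ′ₙ` of `Δ` and `Δ′`:
`C⁻¹λₙ ≤ λ′ₙ ≤ Cλₙ`, `n ≥ 1` (2.52), with some constant `C` independent of `n`."

## What is proved (all over `𝕜 = ℝ` or `ℂ`), and what is not

(2.52) is proved in COUNTING-FUNCTION form, `N(λ) := #{i : μᵢ < λ}` (for increasingly enumerated eigenvalues with
multiplicity, `N(λ) ≤ N′(Cλ)` for all `λ` says exactly `λ′ₙ ≤ Cλₙ` for all `n`), for the two OUTER Laplacians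
`Δ₀ = T*T` (form `‖Tw‖²` on `D(T)`) and `Δ₂ = SS*` (form `‖S*z‖²` on `D(S*)`) of the short complex `0 → E →T F →S G → 0`
— equivalently for every `D*_i D_i` on `(Ker D_i)^⊥` and `D_{i−1}D*_{i−1}` — given eigenbases on both sides:
* §1 **`adjoint_map_of_map`**: "`h := (g⁻¹)*` is also a complex map" between the dual complexes — if `T ∘ k_E = k_F ∘ T′`
  on `D(T′)` then `k_F*(D(T*)) ⊆ D(T′*)` and `T′* ∘ k_F* = k_E* ∘ T*` on `D(T*)`.
* §2 **`ncard_eigenvalue_lt_le_of_form_le`**, the max–min comparison principle behind (2.51) ⇒ (2.52): for two Laplacians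
  `□`, `□′` of Hilbert complexes with eigenbases and a linear `k : F → F′` carrying the form domain `D(T*) ∩ D(S)` into
  `D(T′*) ∩ D(S′)` with `Q′(ku) ≤ C·Q(u)` and `c‖u‖² ≤ ‖ku‖²` (`C, c > 0`), `#{i : μᵢ < λ} ≤ #{j : μ′ⱼ < (C/c)λ}` for
  every real `λ`.
* §3 **`ncard_eigenvalue_adjointCompSelf_lt_le_of_map`** / **`ncard_eigenvalue_adjointCompSelf_lt_le_of_iso`**: (2.52)
  for `T*T` versus `T′*T′` under a map of complexes `g` with `‖g_F‖ ≤ M_g` and `‖w‖ ≤ M_k‖g_E w‖` (for an isomorphism: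
  `‖k_E‖ ≤ M_k`), constant `(M_g M_k)²`, both inequalities for an isomorphism.
* §4 **`ncard_eigenvalue_selfCompAdjoint_lt_le_of_map`** / **`ncard_eigenvalue_selfCompAdjoint_lt_le_of_iso`**: (2.52)
  for `SS*` versus `S′S′*`, through the adjoint map `k_G*` of §1 (BL92's `h = (g⁻¹)*`).
NOT in this file: the middle Laplacian `□ = TT* + S*S` (BL92's mixed map `k = h ⊕ g ⊕ ĝ` on the weak Hodge decomposition,
or the supersymmetric count `N_□ = N_{T*T} + N_{SS*}` off zero), and the existence half of "discreteness is invariant"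
(an eigenbasis for `Δ′` from one for `Δ`); both complexes are ASSUMED discrete here. -- TODO(general form): middle degree.

## References

* [BruningLesch1992] J. Brüning, M. Lesch, *Hilbert complexes*, J. Funct. Anal. 108 (1992) 88–132, §2 Lemma 2.17 with
  (2.50)–(2.52), p. 103 (`h := (g⁻¹)*`), Cor 2.19.
* [Schmudgen2012] K. Schmüdgen, *Unbounded Self-adjoint Operators on Hilbert Space*, GTM 265, §12.1 Thm 12.1, Lemma 12.2
  (max–min principle, through `HilbertComplexMinMax.lean`).
-/

noncomputable section

open scoped InnerProductSpace LinearPMap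
open Filter Topology

namespace Literature.Analysis.InnerProduct

variable {𝕜 E F G E' F' G' : Type*} [RCLike 𝕜]
variable [NormedAddCommGroup E] [InnerProductSpace 𝕜 E]
variable [NormedAddCommGroup F] [InnerProductSpace 𝕜 F]
variable [NormedAddCommGroup G] [InnerProductSpace 𝕜 G]
variable [NormedAddCommGroup E'] [InnerProductSpace 𝕜 E']
variable [NormedAddCommGroup F'] [InnerProductSpace 𝕜 F']
variable [NormedAddCommGroup G'] [InnerProductSpace 𝕜 G']

/-! ### §0 Plumbing: the zero end of a window, adjoints of bounded maps, a pigeonhole -/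

section Zero

variable {D : Type*} [NormedAddCommGroup D] [InnerProductSpace 𝕜 D]

omit [NormedAddCommGroup F] [InnerProductSpace 𝕜 F] [NormedAddCommGroup G] [InnerProductSpace 𝕜 G]
  [NormedAddCommGroup E'] [InnerProductSpace 𝕜 E'] [NormedAddCommGroup F'] [InnerProductSpace 𝕜 F']
  [NormedAddCommGroup G'] [InnerProductSpace 𝕜 G'] in
/-- The zero operator is everywhere, hence densely, defined. [folklore] -/
private theorem dense_zero_pmap_domain : Dense (((0 : D →ₗ.[𝕜] E).domain : Submodule 𝕜 D) : Set D) := by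
  rw [LinearPMap.zero_domain, Submodule.top_coe]; exact dense_univ

omit [NormedAddCommGroup F] [InnerProductSpace 𝕜 F] [NormedAddCommGroup G] [InnerProductSpace 𝕜 G]
  [NormedAddCommGroup E'] [InnerProductSpace 𝕜 E'] [NormedAddCommGroup F'] [InnerProductSpace 𝕜 F']
  [NormedAddCommGroup G'] [InnerProductSpace 𝕜 G'] in
/-- `0* = 0` on `D(0*) =` everything. [folklore] -/
private theorem adjoint_zero_pmap_apply [CompleteSpace D] (y : E) :
    ∃ h : y ∈ (0 : D →ₗ.[𝕜] E)†.domain, (0 : D →ₗ.[𝕜] E)† ⟨y, h⟩ = 0 := by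
  have key : ∀ x : (0 : D →ₗ.[𝕜] E).domain, ⟪(0 : D), (x : D)⟫_𝕜 = ⟪y, (0 : D →ₗ.[𝕜] E) x⟫_𝕜 := fun x ↦ by
    have h : ((0 : D →ₗ.[𝕜] E) x : E) = 0 := LinearPMap.zero_apply x
    rw [h, inner_zero_left, inner_zero_right]
  exact ⟨LinearPMap.mem_adjoint_domain_of_exists _ ⟨0, key⟩,
    LinearPMap.adjoint_apply_eq dense_zero_pmap_domain ⟨y, _⟩ key⟩

end Zero

omit [NormedAddCommGroup G] [InnerProductSpace 𝕜 G] [NormedAddCommGroup E'] [InnerProductSpace 𝕜 E']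
  [NormedAddCommGroup F'] [InnerProductSpace 𝕜 F'] [NormedAddCommGroup G'] [InnerProductSpace 𝕜 G'] in
/-- A bound `‖Ax‖ ≤ M‖x‖` passes to the adjoint: `‖A*y‖ ≤ M‖y‖` (`‖A*‖ = ‖A‖`). [folklore] -/
private theorem norm_adjoint_apply_le [CompleteSpace E] [CompleteSpace F] (A : E →L[𝕜] F) {M : ℝ} (hM : 0 ≤ M)
    (hA : ∀ x : E, ‖A x‖ ≤ M * ‖x‖) (y : F) : ‖ContinuousLinearMap.adjoint A y‖ ≤ M * ‖y‖ :=
  calc ‖ContinuousLinearMap.adjoint A y‖ ≤ ‖ContinuousLinearMap.adjoint A‖ * ‖y‖ :=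
        (ContinuousLinearMap.adjoint A).le_opNorm y
    _ = ‖A‖ * ‖y‖ := by rw [LinearIsometryEquiv.norm_map]
    _ ≤ M * ‖y‖ := mul_le_mul_of_nonneg_right (ContinuousLinearMap.opNorm_le_bound _ hM hA) (norm_nonneg _)

omit [NormedAddCommGroup G] [InnerProductSpace 𝕜 G] [NormedAddCommGroup E'] [InnerProductSpace 𝕜 E']
  [NormedAddCommGroup F'] [InnerProductSpace 𝕜 F'] [NormedAddCommGroup G'] [InnerProductSpace 𝕜 G'] in
/-- `k ∘ g = id ⇒ g* ∘ k* = id` (pointwise). [folklore] -/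
private theorem adjoint_apply_adjoint_apply_of_leftInverse [CompleteSpace E] [CompleteSpace F] {g : E →L[𝕜] F}
    {k : F →L[𝕜] E} (hkg : ∀ x : E, k (g x) = x) (z : E) :
    ContinuousLinearMap.adjoint g (ContinuousLinearMap.adjoint k z) = z := by
  refine ext_inner_right 𝕜 fun x ↦ ?_
  rw [ContinuousLinearMap.adjoint_inner_left, ContinuousLinearMap.adjoint_inner_left, hkg]

omit [NormedAddCommGroup E] [InnerProductSpace 𝕜 E] [NormedAddCommGroup G] [InnerProductSpace 𝕜 G]
  [NormedAddCommGroup E'] [InnerProductSpace 𝕜 E'] [NormedAddCommGroup G'] [InnerProductSpace 𝕜 G'] in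
/-- **Pigeonhole**: `#s` linear conditions `(e′ⱼ, kv) = 0` on a space `V` of dimension `> #s` have a non-zero solution
(rank–nullity). [folklore] -/
private theorem exists_mem_ne_zero_forall_inner_eq_zero {ι' : Type*} (V : Submodule 𝕜 F) [FiniteDimensional 𝕜 V]
    (k : F →ₗ[𝕜] F') (e : ι' → F') {s : Set ι'} (hs : s.Finite) (hlt : s.ncard < Module.finrank 𝕜 V) :
    ∃ v ∈ V, v ≠ 0 ∧ ∀ j ∈ s, ⟪e j, k v⟫_𝕜 = 0 := by
  classical
  haveI : Fintype s := hs.fintype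
  let φ : V →ₗ[𝕜] (s → 𝕜) := LinearMap.pi fun j ↦ (innerₛₗ 𝕜 (e j)).comp (k.comp V.subtype)
  have hlt' : Module.finrank 𝕜 (s → 𝕜) < Module.finrank 𝕜 V := by
    rw [Module.finrank_fintype_fun_eq_card, ← Set.toFinset_card, ← Set.ncard_eq_toFinset_card']
    exact hlt
  obtain ⟨x, hx, hx0⟩ := Submodule.exists_mem_ne_zero_of_ne_bot (LinearMap.ker_ne_bot_of_finrank_lt (f := φ) hlt')
  refine ⟨x, x.2, fun h ↦ hx0 (Subtype.ext h), fun j hj ↦ ?_⟩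
  have h := congr_fun (LinearMap.mem_ker.1 hx) ⟨j, hj⟩
  simpa [φ] using h

omit [NormedAddCommGroup E] [InnerProductSpace 𝕜 E] [NormedAddCommGroup F] [InnerProductSpace 𝕜 F]
  [NormedAddCommGroup G] [InnerProductSpace 𝕜 G] [NormedAddCommGroup E'] [InnerProductSpace 𝕜 E']
  [NormedAddCommGroup G'] [InnerProductSpace 𝕜 G'] in
/-- `(eⱼ, w) = 0` for `j ∈ s` puts `w` orthogonal to `span{eⱼ : j ∈ s}`. [folklore] -/
private theorem mem_orthogonal_span_image_of_forall_inner_eq_zero {ι' : Type*} (e : ι' → F') {s : Set ι'} {w : F'}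
    (hw : ∀ j ∈ s, ⟪e j, w⟫_𝕜 = 0) : w ∈ (Submodule.span 𝕜 (e '' s))ᗮ := by
  rw [Submodule.mem_orthogonal]
  intro x hx
  induction hx using Submodule.span_induction with
  | mem y hy =>
    obtain ⟨j, hj, rfl⟩ := hy
    exact hw j hj
  | zero => exact inner_zero_left _
  | add y z _ _ hy hz => rw [inner_add_left, hy, hz, add_zero]
  | smul a y _ hy => rw [inner_smul_left, hy, mul_zero]

/-! ### §1 "`h := (g⁻¹)*` is also a complex map": adjoints of a map of complexes map the dual complexes -/

section AdjointMap

variable [CompleteSpace E] [CompleteSpace F] [CompleteSpace E'] [CompleteSpace F']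
variable {T : E →ₗ.[𝕜] F} {T' : E' →ₗ.[𝕜] F'} {k_E : E' →L[𝕜] E} {k_F : F' →L[𝕜] F}

omit [NormedAddCommGroup G] [InnerProductSpace 𝕜 G] [NormedAddCommGroup G'] [InnerProductSpace 𝕜 G'] in
/-- **The adjoints of a map of complexes form a map of the dual complexes, in the opposite direction**: if bounded
`k_E : E′ → E`, `k_F : F′ → F` satisfy `k_E(D(T′)) ⊆ D(T)` and `T ∘ k_E = k_F ∘ T′` on `D(T′)` (for densely defined
`T`, `T′`), then `k_F*(D(T*)) ⊆ D(T′*)` and `T′* ∘ k_F* = k_E* ∘ T*` on `D(T*)` (`(k_F*v, T′w′) = (v, k_F T′w′) =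
(v, T k_E w′) = (T*v, k_E w′) = (k_E* T*v, w′)` is bounded in `w′`). [cite: BruningLesch1992, §2 p. 103 ("`h :=
(g⁻¹)* : (𝒟*, D*) → (𝒟′*, D′*)` is also a complex isomorphism"), with (2.7a)–(2.7b) and Cor 2.6] -/
theorem adjoint_map_of_map (hdT : Dense (T.domain : Set E)) (hdT' : Dense (T'.domain : Set E'))
    (hkT : ∀ (w' : E') (hw' : w' ∈ T'.domain), ∃ h : k_E w' ∈ T.domain, T ⟨k_E w', h⟩ = k_F (T' ⟨w', hw'⟩))
    (v : F) (hv : v ∈ T†.domain) :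
    ∃ h : ContinuousLinearMap.adjoint k_F v ∈ T'†.domain,
      T'† ⟨ContinuousLinearMap.adjoint k_F v, h⟩ = ContinuousLinearMap.adjoint k_E (T† ⟨v, hv⟩) := by
  have key : ∀ w' : T'.domain, ⟪(ContinuousLinearMap.adjoint k_E (T† ⟨v, hv⟩) : E'), (w' : E')⟫_𝕜 =
      ⟪ContinuousLinearMap.adjoint k_F v, T' w'⟫_𝕜 := fun w' ↦ by
    obtain ⟨hw, hTw⟩ := hkT w' w'.2
    have h1 : ⟪(T† ⟨v, hv⟩ : E), k_E w'⟫_𝕜 = ⟪v, (T ⟨k_E w', hw⟩ : F)⟫_𝕜 :=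
      LinearPMap.adjoint_isFormalAdjoint hdT ⟨v, hv⟩ ⟨k_E w', hw⟩
    rw [ContinuousLinearMap.adjoint_inner_left, ContinuousLinearMap.adjoint_inner_left, h1, hTw]
  have hmem : ContinuousLinearMap.adjoint k_F v ∈ T'†.domain := LinearPMap.mem_adjoint_domain_of_exists _ ⟨_, key⟩
  exact ⟨hmem, LinearPMap.adjoint_apply_eq hdT' ⟨_, hmem⟩ key⟩

end AdjointMap

/-! ### §2 The max–min comparison principle: a form-bounded, norm-coercive map between form domains compares the
counting functions -/

section Comparison

variable [CompleteSpace E] [CompleteSpace F] [CompleteSpace E'] [CompleteSpace F']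
variable {T : E →ₗ.[𝕜] F} {S : F →ₗ.[𝕜] G} {L : F →ₗ.[𝕜] F} {ι : Type*} {b : HilbertBasis ι 𝕜 F} {μ : ι → ℝ}
variable {T' : E' →ₗ.[𝕜] F'} {S' : F' →ₗ.[𝕜] G'} {L' : F' →ₗ.[𝕜] F'} {ι' : Type*} {b' : HilbertBasis ι' 𝕜 F'}
  {μ' : ι' → ℝ}

/-- **Max–min comparison of two discrete Laplacians.** Let `□ = TT* + S*S` on `F` and `□′ = T′T′* + S′*S′` on `F′` have
Hilbert bases of eigenvectors `eᵢ`, `e′ⱼ` with eigenvalues `μᵢ → ∞`, `μ′ⱼ → ∞`, and let `k : F → F′` be linear with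
`k(D(T*) ∩ D(S)) ⊆ D(T′*) ∩ D(S′)`, `‖T′*ku‖² + ‖S′ku‖² ≤ C(‖T*u‖² + ‖Su‖²)` and `c‖u‖² ≤ ‖ku‖²` on `D(T*) ∩ D(S)`
(`C, c > 0`). Then `#{i : μᵢ < λ} ≤ #{j : μ′ⱼ < (C/c)λ}` for every `λ` — i.e. `λ′ₙ ≤ (C/c)λₙ` for the increasingly
enumerated eigenvalues. Proof as printed ("this situation calls for an application of the max-min-principle"): on
`ℰ_λ = span{eᵢ : μᵢ < λ}` the form is `< λ‖v‖²`; if `#{μ′ⱼ < (C/c)λ} < dim ℰ_λ`, some `v ∈ ℰ_λ ∖ 0` has `kv ⊥ ℰ′_{(C/c)λ}`,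
so `(C/c)λ‖kv‖² ≤ Q′(kv) ≤ CQ(v) < Cλ‖v‖² ≤ (C/c)λ‖kv‖²`. [cite: BruningLesch1992, §2 Lemma 2.17 (proof, (2.51) ⇒
(2.52)); Schmudgen2012, §12.1 Thm 12.1, Lemma 12.2 (12.5)–(12.6)] -/
theorem ncard_eigenvalue_lt_le_of_form_le (hdT : Dense (T.domain : Set E)) (hdS : Dense (S.domain : Set F))
    (hdom : ∀ x : F, x ∈ L.domain ↔ (∃ hxT : x ∈ T†.domain, T† ⟨x, hxT⟩ ∈ T.domain) ∧
      (∃ hxS : x ∈ S.domain, S ⟨x, hxS⟩ ∈ S†.domain))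
    (hval : ∀ (x : L.domain) (hxT : (x : F) ∈ T†.domain) (hTx : T† ⟨x, hxT⟩ ∈ T.domain)
      (hxS : (x : F) ∈ S.domain) (hSx : S ⟨x, hxS⟩ ∈ S†.domain),
      L x = T ⟨T† ⟨x, hxT⟩, hTx⟩ + S† ⟨S ⟨x, hxS⟩, hSx⟩)
    (heig : ∀ i, ∃ h : (b i : F) ∈ L.domain, L ⟨b i, h⟩ = ((μ i : ℝ) : 𝕜) • (b i : F))
    (htend : Tendsto μ cofinite atTop)
    (hdT' : Dense (T'.domain : Set E')) (hdS' : Dense (S'.domain : Set F'))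
    (hdom' : ∀ x : F', x ∈ L'.domain ↔ (∃ hxT : x ∈ T'†.domain, T'† ⟨x, hxT⟩ ∈ T'.domain) ∧
      (∃ hxS : x ∈ S'.domain, S' ⟨x, hxS⟩ ∈ S'†.domain))
    (hval' : ∀ (x : L'.domain) (hxT : (x : F') ∈ T'†.domain) (hTx : T'† ⟨x, hxT⟩ ∈ T'.domain)
      (hxS : (x : F') ∈ S'.domain) (hSx : S' ⟨x, hxS⟩ ∈ S'†.domain),
      L' x = T' ⟨T'† ⟨x, hxT⟩, hTx⟩ + S'† ⟨S' ⟨x, hxS⟩, hSx⟩)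
    (heig' : ∀ j, ∃ h : (b' j : F') ∈ L'.domain, L' ⟨b' j, h⟩ = ((μ' j : ℝ) : 𝕜) • (b' j : F'))
    (htend' : Tendsto μ' cofinite atTop)
    (k : F →ₗ[𝕜] F') {C c : ℝ} (hC : 0 < C) (hc : 0 < c)
    (hk : ∀ (u : F) (huT : u ∈ T†.domain) (huS : u ∈ S.domain),
      ∃ (h₁ : k u ∈ T'†.domain) (h₂ : k u ∈ S'.domain),
        ‖T'† ⟨k u, h₁⟩‖ ^ 2 + ‖S' ⟨k u, h₂⟩‖ ^ 2 ≤ C * (‖T† ⟨u, huT⟩‖ ^ 2 + ‖S ⟨u, huS⟩‖ ^ 2))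
    (hkn : ∀ u : F, u ∈ T†.domain → u ∈ S.domain → c * ‖u‖ ^ 2 ≤ ‖k u‖ ^ 2) (l : ℝ) :
    {i | μ i < l}.ncard ≤ {j | μ' j < C / c * l}.ncard := by
  classical
  have hs : {i | μ i < l}.Finite := (finrank_span_eigenvectors_lt b htend l).1
  have hs' : {j | μ' j < C / c * l}.Finite := (finrank_span_eigenvectors_lt b' htend' _).1
  by_contra hlt
  rw [not_le] at hlt
  set V := Submodule.span 𝕜 ((fun i ↦ (b i : F)) '' {i | μ i < l}) with hV
  haveI : FiniteDimensional 𝕜 V := FiniteDimensional.span_of_finite 𝕜 (hs.image _)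
  have hfr : Module.finrank 𝕜 V = {i | μ i < l}.ncard := (finrank_span_eigenvectors_lt b htend l).2
  obtain ⟨v, hvV, hv0, hv⟩ :=
    exists_mem_ne_zero_forall_inner_eq_zero V k (fun j ↦ (b' j : F')) hs' (hfr ▸ hlt)
  have hvL : v ∈ L.domain := span_eigenvectors_le_laplacian_domain heig _ hvV
  have hvT : v ∈ T†.domain := laplacian_domain_le_adjoint_domain hdom hvL
  have hvS : v ∈ S.domain := laplacian_domain_le_domain hdom hvL
  -- on the low modes the form is `< λ‖v‖²`
  have hQ : ‖T† ⟨v, hvT⟩‖ ^ 2 + ‖S ⟨v, hvS⟩‖ ^ 2 < l * ‖v‖ ^ 2 := by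
    have h := re_inner_laplacian_lt_mul_norm_sq hdT hdS hdom hval heig htend ⟨v, hvL⟩
      (fun i hi ↦ inner_eigenvector_eq_zero_of_mem_span b hvV fun h ↦ (not_lt.2 hi) h) hv0
    rwa [re_inner_laplacian_self hdT hdS hdom hval ⟨v, hvL⟩] at h
  obtain ⟨h₁, h₂, hq⟩ := hk v hvT hvS
  -- `kv ⊥ ℰ′_{(C/c)λ}`, hence `(C/c)λ‖kv‖² ≤ Q′(kv)`
  have hlow : C / c * l * ‖k v‖ ^ 2 ≤ ‖T'† ⟨k v, h₁⟩‖ ^ 2 + ‖S' ⟨k v, h₂⟩‖ ^ 2 :=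
    mul_norm_sq_le_form_of_mem_orthogonal_span hdT' hdS' hdom' hval' heig' h₁ h₂
      (mem_orthogonal_span_image_of_forall_inner_eq_zero _ hv)
  have hkv : c * ‖v‖ ^ 2 ≤ ‖k v‖ ^ 2 := hkn v hvT hvS
  have hQ0 : 0 ≤ ‖T† ⟨v, hvT⟩‖ ^ 2 + ‖S ⟨v, hvS⟩‖ ^ 2 := by positivity
  rcases le_or_gt l 0 with hl | hl
  · nlinarith [sq_nonneg ‖v‖]
  · have h3 : C * (‖T† ⟨v, hvT⟩‖ ^ 2 + ‖S ⟨v, hvS⟩‖ ^ 2) < C * (l * ‖v‖ ^ 2) := mul_lt_mul_of_pos_left hQ hC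
    have h4 : C * (l * ‖v‖ ^ 2) ≤ C / c * l * ‖k v‖ ^ 2 := by
      have h5 : C / c * l * (c * ‖v‖ ^ 2) ≤ C / c * l * ‖k v‖ ^ 2 :=
        mul_le_mul_of_nonneg_left hkv (by positivity)
      have hc0 : c ≠ 0 := hc.ne'
      calc C * (l * ‖v‖ ^ 2) = C / c * l * (c * ‖v‖ ^ 2) := by field_simp
        _ ≤ _ := h5
    exact absurd (h4.trans (hlow.trans hq)) (not_le.2 h3)

end Comparison

/-! ### §3 Lemma 2.17 for `Δ₀ = T*T`: the comparison map is `g_E` itself (`‖T′g_E w‖ = ‖g_F Tw‖ ≤ M_g‖Tw‖`,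
`‖w‖ ≤ M_k‖g_E w‖`) -/

section DegreeZero

variable [CompleteSpace E] [CompleteSpace E']
variable {T : E →ₗ.[𝕜] F} {A : E →ₗ.[𝕜] E} {ι : Type*} {b : HilbertBasis ι 𝕜 E} {μ : ι → ℝ}
variable {T' : E' →ₗ.[𝕜] F'} {A' : E' →ₗ.[𝕜] E'} {ι' : Type*} {b' : HilbertBasis ι' 𝕜 E'} {μ' : ι' → ℝ}
variable {g_E : E →L[𝕜] E'} {g_F : F →L[𝕜] F'} {k_E : E' →L[𝕜] E} {k_F : F' →L[𝕜] F}

omit [NormedAddCommGroup G] [InnerProductSpace 𝕜 G] [NormedAddCommGroup G'] [InnerProductSpace 𝕜 G'] in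
/-- **Lemma 2.17 (2.52), degree `0`, one map**: let `T*T` (on `D(T*T) = {w ∈ D(T) : Tw ∈ D(T*)}`) and `T′*T′` have
Hilbert bases of eigenvectors with eigenvalues `μᵢ → ∞`, `μ′ⱼ → ∞`, and let `(g_E, g_F)` be a map of complexes
(`T′g_E = g_F T` on `D(T)`) with `‖g_F y‖ ≤ M_g‖y‖` and `‖w‖ ≤ M_k‖g_E w‖`. Then `#{i : μᵢ < λ} ≤ #{j : μ′ⱼ <
(M_g M_k)²λ}` for all `λ` (`λ′ₙ ≤ Cλₙ` with `C = (M_g M_k)²`: the form of `T*T` is `‖Tw‖²`, and `‖T′g_E w‖² = ‖g_F Tw‖² ≤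
M_g²‖Tw‖²`, `‖g_E w‖² ≥ M_k⁻²‖w‖²`). [cite: BruningLesch1992, §2 Lemma 2.17 (2.52) with (2.51) (`C′(k(u), k(u)) =
‖g_{i+1} D_i u₂‖² + … ≤ C …` "since `g` is a complex isomorphism"); Schmudgen2012, §12.1 Thm 12.1] -/
theorem ncard_eigenvalue_adjointCompSelf_lt_le_of_map (hdT : Dense (T.domain : Set E))
    (hdomA : ∀ x : E, x ∈ A.domain ↔ ∃ hx : x ∈ T.domain, T ⟨x, hx⟩ ∈ T†.domain)
    (hvalA : ∀ (x : A.domain) (hx : (x : E) ∈ T.domain) (hTx : T ⟨x, hx⟩ ∈ T†.domain),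
      A x = T† ⟨T ⟨x, hx⟩, hTx⟩)
    (heig : ∀ i, ∃ h : (b i : E) ∈ A.domain, A ⟨b i, h⟩ = ((μ i : ℝ) : 𝕜) • (b i : E))
    (htend : Tendsto μ cofinite atTop)
    (hdT' : Dense (T'.domain : Set E'))
    (hdomA' : ∀ x : E', x ∈ A'.domain ↔ ∃ hx : x ∈ T'.domain, T' ⟨x, hx⟩ ∈ T'†.domain)
    (hvalA' : ∀ (x : A'.domain) (hx : (x : E') ∈ T'.domain) (hTx : T' ⟨x, hx⟩ ∈ T'†.domain),
      A' x = T'† ⟨T' ⟨x, hx⟩, hTx⟩)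
    (heig' : ∀ j, ∃ h : (b' j : E') ∈ A'.domain, A' ⟨b' j, h⟩ = ((μ' j : ℝ) : 𝕜) • (b' j : E'))
    (htend' : Tendsto μ' cofinite atTop)
    (hgT : ∀ (w : E) (hw : w ∈ T.domain), ∃ h : g_E w ∈ T'.domain, T' ⟨g_E w, h⟩ = g_F (T ⟨w, hw⟩))
    {Mg Mk : ℝ} (hMg : 0 < Mg) (hMk : 0 < Mk) (hgF : ∀ y : F, ‖g_F y‖ ≤ Mg * ‖y‖)
    (hkE : ∀ w : E, ‖w‖ ≤ Mk * ‖g_E w‖) (l : ℝ) :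
    {i | μ i < l}.ncard ≤ {j | μ' j < (Mg * Mk) ^ 2 * l}.ncard := by
  have e : Mg ^ 2 / (Mk ^ 2)⁻¹ = (Mg * Mk) ^ 2 := by rw [div_inv_eq_mul, mul_pow]
  rw [← e]
  refine ncard_eigenvalue_lt_le_of_form_le (T := (0 : E →ₗ.[𝕜] E)) (S := T) (T' := (0 : E' →ₗ.[𝕜] E'))
    (S' := T') dense_zero_pmap_domain hdT (laplacian_domain_iff_of_adjointCompSelf hdomA)
    (laplacian_apply_of_adjointCompSelf hvalA) heig htend dense_zero_pmap_domain hdT'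
    (laplacian_domain_iff_of_adjointCompSelf hdomA') (laplacian_apply_of_adjointCompSelf hvalA') heig' htend'
    (g_E : E →ₗ[𝕜] E') (pow_pos hMg 2) (inv_pos.2 (pow_pos hMk 2)) (fun u huR huT ↦ ?_) (fun u _ _ ↦ ?_) l
  · obtain ⟨h₁, h0'⟩ := adjoint_zero_pmap_apply (D := E') (𝕜 := 𝕜) (g_E u)
    obtain ⟨h₂, hT'⟩ := hgT u huT
    have h0 : (0 : E →ₗ.[𝕜] E)† ⟨u, huR⟩ = 0 := (adjoint_zero_pmap_apply (D := E) (𝕜 := 𝕜) u).2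
    have h0'' : (0 : E' →ₗ.[𝕜] E')† ⟨(g_E : E →ₗ[𝕜] E') u, h₁⟩ = 0 := h0'
    have hT'' : T' ⟨(g_E : E →ₗ[𝕜] E') u, h₂⟩ = g_F (T ⟨u, huT⟩) := hT'
    refine ⟨h₁, h₂, ?_⟩
    rw [h0, h0'', hT'']
    have h6 : ‖g_F (T ⟨u, huT⟩)‖ ^ 2 ≤ (Mg * ‖T ⟨u, huT⟩‖) ^ 2 :=
      pow_le_pow_left₀ (norm_nonneg _) (hgF _) 2
    rw [mul_pow] at h6
    simpa using h6
  · have h7 : ‖u‖ ^ 2 ≤ (Mk * ‖g_E u‖) ^ 2 := pow_le_pow_left₀ (norm_nonneg _) (hkE u) 2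
    rw [mul_pow] at h7
    rw [ContinuousLinearMap.coe_coe, inv_mul_le_iff₀ (pow_pos hMk 2)]
    exact h7

omit [NormedAddCommGroup G] [InnerProductSpace 𝕜 G] [NormedAddCommGroup G'] [InnerProductSpace 𝕜 G'] in
/-- **Lemma 2.17 (2.52), degree `0`, for an isomorphism of complexes** `(g_E, g_F) ⇄ (k_E, k_F)` (`k ∘ g = id`,
`g ∘ k = id` on `E`, `E′`) with `‖g_E‖, ‖g_F‖ ≤ M_g` and `‖k_E‖, ‖k_F‖ ≤ M_k`: BOTH `#{μᵢ < λ} ≤ #{μ′ⱼ < Cλ}` and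
`#{μ′ⱼ < λ} ≤ #{μᵢ < Cλ}` with `C = (M_g M_k)²` — "`C⁻¹λₙ ≤ λ′ₙ ≤ Cλₙ`, `n ≥ 1`, with some constant `C` independent of
`n`" for `Δ₀ = T*T`. [cite: BruningLesch1992, §2 Lemma 2.17 (2.52); Schmudgen2012, §12.1 Thm 12.1] -/
theorem ncard_eigenvalue_adjointCompSelf_lt_le_of_iso (hdT : Dense (T.domain : Set E))
    (hdomA : ∀ x : E, x ∈ A.domain ↔ ∃ hx : x ∈ T.domain, T ⟨x, hx⟩ ∈ T†.domain)
    (hvalA : ∀ (x : A.domain) (hx : (x : E) ∈ T.domain) (hTx : T ⟨x, hx⟩ ∈ T†.domain),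
      A x = T† ⟨T ⟨x, hx⟩, hTx⟩)
    (heig : ∀ i, ∃ h : (b i : E) ∈ A.domain, A ⟨b i, h⟩ = ((μ i : ℝ) : 𝕜) • (b i : E))
    (htend : Tendsto μ cofinite atTop)
    (hdT' : Dense (T'.domain : Set E'))
    (hdomA' : ∀ x : E', x ∈ A'.domain ↔ ∃ hx : x ∈ T'.domain, T' ⟨x, hx⟩ ∈ T'†.domain)
    (hvalA' : ∀ (x : A'.domain) (hx : (x : E') ∈ T'.domain) (hTx : T' ⟨x, hx⟩ ∈ T'†.domain),
      A' x = T'† ⟨T' ⟨x, hx⟩, hTx⟩)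
    (heig' : ∀ j, ∃ h : (b' j : E') ∈ A'.domain, A' ⟨b' j, h⟩ = ((μ' j : ℝ) : 𝕜) • (b' j : E'))
    (htend' : Tendsto μ' cofinite atTop)
    (hgT : ∀ (w : E) (hw : w ∈ T.domain), ∃ h : g_E w ∈ T'.domain, T' ⟨g_E w, h⟩ = g_F (T ⟨w, hw⟩))
    (hkT : ∀ (w' : E') (hw' : w' ∈ T'.domain), ∃ h : k_E w' ∈ T.domain, T ⟨k_E w', h⟩ = k_F (T' ⟨w', hw'⟩))
    (hkg_E : ∀ w : E, k_E (g_E w) = w) (hgk_E : ∀ w' : E', g_E (k_E w') = w')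
    {Mg Mk : ℝ} (hMg : 0 < Mg) (hMk : 0 < Mk) (hgE : ∀ w : E, ‖g_E w‖ ≤ Mg * ‖w‖)
    (hgF : ∀ y : F, ‖g_F y‖ ≤ Mg * ‖y‖) (hkE : ∀ w' : E', ‖k_E w'‖ ≤ Mk * ‖w'‖)
    (hkF : ∀ y' : F', ‖k_F y'‖ ≤ Mk * ‖y'‖) (l : ℝ) :
    {i | μ i < l}.ncard ≤ {j | μ' j < (Mg * Mk) ^ 2 * l}.ncard ∧
      {j | μ' j < l}.ncard ≤ {i | μ i < (Mg * Mk) ^ 2 * l}.ncard := by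
  refine ⟨ncard_eigenvalue_adjointCompSelf_lt_le_of_map hdT hdomA hvalA heig htend hdT' hdomA' hvalA' heig'
    htend' hgT hMg hMk hgF (fun w ↦ ?_) l, ?_⟩
  · calc ‖w‖ = ‖k_E (g_E w)‖ := by rw [hkg_E]
      _ ≤ Mk * ‖g_E w‖ := hkE _
  · rw [mul_comm Mg Mk]
    refine ncard_eigenvalue_adjointCompSelf_lt_le_of_map hdT' hdomA' hvalA' heig' htend' hdT hdomA hvalA heig
      htend hkT hMk hMg hkF (fun w' ↦ ?_) l
    calc ‖w'‖ = ‖g_E (k_E w')‖ := by rw [hgk_E]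
      _ ≤ Mg * ‖k_E w'‖ := hgE _

end DegreeZero

/-! ### §4 Lemma 2.17 for `Δ₂ = SS*`: the comparison map is `h = (k_G)*`, the adjoint of the inverse
(`S′*k_G* = k_F*S*` by §1, `‖k_F*S*z‖ ≤ M_k‖S*z‖`, `z = g_G*k_G*z` so `‖z‖ ≤ M_g‖k_G*z‖`) -/

section DegreeTwo

variable [CompleteSpace F] [CompleteSpace G] [CompleteSpace F'] [CompleteSpace G']
variable {S : F →ₗ.[𝕜] G} {C : G →ₗ.[𝕜] G} {ι : Type*} {b : HilbertBasis ι 𝕜 G} {μ : ι → ℝ}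
variable {S' : F' →ₗ.[𝕜] G'} {C' : G' →ₗ.[𝕜] G'} {ι' : Type*} {b' : HilbertBasis ι' 𝕜 G'} {μ' : ι' → ℝ}
variable {g_F : F →L[𝕜] F'} {g_G : G →L[𝕜] G'} {k_F : F' →L[𝕜] F} {k_G : G' →L[𝕜] G}

omit [NormedAddCommGroup E] [InnerProductSpace 𝕜 E] [NormedAddCommGroup E'] [InnerProductSpace 𝕜 E'] in
/-- **Lemma 2.17 (2.52), degree `2`, one map**: let `SS*` (on `D(SS*) = {z ∈ D(S*) : S*z ∈ D(S)}`) and `S′S′*` have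
Hilbert bases of eigenvectors with `μᵢ → ∞`, `μ′ⱼ → ∞`; let `(k_F, k_G)` be a map of complexes from the primed complex
back (`S k_F = k_G S′` on `D(S′)`) with `‖k_F‖ ≤ M_k`, and `g_G` a bounded right inverse datum `k_G ∘ g_G = id` with
`‖g_G‖ ≤ M_g`. Then `#{i : μᵢ < λ} ≤ #{j : μ′ⱼ < (M_g M_k)²λ}` for all `λ`: the comparison map is `h = k_G*`
("`h := (g⁻¹)*` … is also a complex isomorphism"), with `‖S′*k_G*z‖ = ‖k_F*S*z‖ ≤ M_k‖S*z‖` and `‖z‖ = ‖g_G*k_G*z‖ ≤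
M_g‖k_G*z‖`. [cite: BruningLesch1992, §2 Lemma 2.17 (2.52) with p. 103 (`h := (g⁻¹)*`) and (2.51)
(`‖(g_{i−1}⁻¹)* D*_{i−1} u₁‖²`); Schmudgen2012, §12.1 Thm 12.1] -/
theorem ncard_eigenvalue_selfCompAdjoint_lt_le_of_map (hdS : Dense (S.domain : Set F))
    (hdomC : ∀ y : G, y ∈ C.domain ↔ ∃ hy : y ∈ S†.domain, S† ⟨y, hy⟩ ∈ S.domain)
    (hvalC : ∀ (y : C.domain) (hy : (y : G) ∈ S†.domain) (hSy : S† ⟨y, hy⟩ ∈ S.domain),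
      C y = S ⟨S† ⟨y, hy⟩, hSy⟩)
    (heig : ∀ i, ∃ h : (b i : G) ∈ C.domain, C ⟨b i, h⟩ = ((μ i : ℝ) : 𝕜) • (b i : G))
    (htend : Tendsto μ cofinite atTop)
    (hdS' : Dense (S'.domain : Set F'))
    (hdomC' : ∀ y : G', y ∈ C'.domain ↔ ∃ hy : y ∈ S'†.domain, S'† ⟨y, hy⟩ ∈ S'.domain)
    (hvalC' : ∀ (y : C'.domain) (hy : (y : G') ∈ S'†.domain) (hSy : S'† ⟨y, hy⟩ ∈ S'.domain),
      C' y = S' ⟨S'† ⟨y, hy⟩, hSy⟩)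
    (heig' : ∀ j, ∃ h : (b' j : G') ∈ C'.domain, C' ⟨b' j, h⟩ = ((μ' j : ℝ) : 𝕜) • (b' j : G'))
    (htend' : Tendsto μ' cofinite atTop)
    (hkS : ∀ (u' : F') (hu' : u' ∈ S'.domain), ∃ h : k_F u' ∈ S.domain, S ⟨k_F u', h⟩ = k_G (S' ⟨u', hu'⟩))
    (hkg_G : ∀ z : G, k_G (g_G z) = z)
    {Mg Mk : ℝ} (hMg : 0 < Mg) (hMk : 0 < Mk) (hgG : ∀ z : G, ‖g_G z‖ ≤ Mg * ‖z‖)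
    (hkF : ∀ y' : F', ‖k_F y'‖ ≤ Mk * ‖y'‖) (l : ℝ) :
    {i | μ i < l}.ncard ≤ {j | μ' j < (Mg * Mk) ^ 2 * l}.ncard := by
  have e : Mk ^ 2 / (Mg ^ 2)⁻¹ = (Mg * Mk) ^ 2 := by rw [div_inv_eq_mul, mul_pow, mul_comm]
  rw [← e]
  refine ncard_eigenvalue_lt_le_of_form_le (T := S) (S := (0 : G →ₗ.[𝕜] G)) (T' := S')
    (S' := (0 : G' →ₗ.[𝕜] G')) hdS dense_zero_pmap_domain (laplacian_domain_iff_of_selfCompAdjoint hdomC)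
    (laplacian_apply_of_selfCompAdjoint hvalC) heig htend hdS' dense_zero_pmap_domain
    (laplacian_domain_iff_of_selfCompAdjoint hdomC') (laplacian_apply_of_selfCompAdjoint hvalC') heig' htend'
    ((ContinuousLinearMap.adjoint k_G : G →L[𝕜] G') : G →ₗ[𝕜] G') (pow_pos hMk 2) (inv_pos.2 (pow_pos hMg 2))
    (fun z hzS hzU ↦ ?_) (fun z _ _ ↦ ?_) l
  · obtain ⟨h₁, hS'⟩ := adjoint_map_of_map (T := S) (T' := S') hdS hdS' hkS z hzS
    have h₁' : ((ContinuousLinearMap.adjoint k_G : G →L[𝕜] G') : G →ₗ[𝕜] G') z ∈ S'†.domain := h₁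
    have hS'' : S'† ⟨((ContinuousLinearMap.adjoint k_G : G →L[𝕜] G') : G →ₗ[𝕜] G') z, h₁'⟩ =
        ContinuousLinearMap.adjoint k_F (S† ⟨z, hzS⟩) := hS'
    have hU : (0 : G →ₗ.[𝕜] G) ⟨z, hzU⟩ = 0 := LinearPMap.zero_apply _
    have hU' : (0 : G' →ₗ.[𝕜] G') ⟨((ContinuousLinearMap.adjoint k_G : G →L[𝕜] G') : G →ₗ[𝕜] G') z,
        (Submodule.mem_top : _ ∈ (⊤ : Submodule 𝕜 G'))⟩ = 0 := LinearPMap.zero_apply _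
    refine ⟨h₁', Submodule.mem_top, ?_⟩
    rw [hS'', hU, hU']
    have h6 : ‖ContinuousLinearMap.adjoint k_F (S† ⟨z, hzS⟩)‖ ^ 2 ≤ (Mk * ‖S† ⟨z, hzS⟩‖) ^ 2 :=
      pow_le_pow_left₀ (norm_nonneg _) (norm_adjoint_apply_le k_F hMk.le hkF _) 2
    rw [mul_pow] at h6
    simpa using h6
  · have h8 : ‖z‖ ≤ Mg * ‖ContinuousLinearMap.adjoint k_G z‖ :=
      calc ‖z‖ = ‖ContinuousLinearMap.adjoint g_G (ContinuousLinearMap.adjoint k_G z)‖ := by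
            rw [adjoint_apply_adjoint_apply_of_leftInverse hkg_G]
        _ ≤ Mg * ‖ContinuousLinearMap.adjoint k_G z‖ := norm_adjoint_apply_le g_G hMg.le hgG _
    have h7 : ‖z‖ ^ 2 ≤ (Mg * ‖ContinuousLinearMap.adjoint k_G z‖) ^ 2 := pow_le_pow_left₀ (norm_nonneg _) h8 2
    rw [mul_pow] at h7
    rw [ContinuousLinearMap.coe_coe, inv_mul_le_iff₀ (pow_pos hMg 2)]
    exact h7

omit [NormedAddCommGroup E] [InnerProductSpace 𝕜 E] [NormedAddCommGroup E'] [InnerProductSpace 𝕜 E'] in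
/-- **Lemma 2.17 (2.52), degree `2`, for an isomorphism of complexes** `(g_F, g_G) ⇄ (k_F, k_G)` (`S′g_F = g_G S` on
`D(S)`, `S k_F = k_G S′` on `D(S′)`, `k_G ∘ g_G = id`, `g_G ∘ k_G = id`) with `‖g_F‖, ‖g_G‖ ≤ M_g` and `‖k_F‖, ‖k_G‖ ≤
M_k`: BOTH `#{μᵢ < λ} ≤ #{μ′ⱼ < Cλ}` and `#{μ′ⱼ < λ} ≤ #{μᵢ < Cλ}` with `C = (M_g M_k)²` for `Δ₂ = SS*` versus
`Δ′₂ = S′S′*`. [cite: BruningLesch1992, §2 Lemma 2.17 (2.52), p. 103; Schmudgen2012, §12.1 Thm 12.1] -/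
theorem ncard_eigenvalue_selfCompAdjoint_lt_le_of_iso (hdS : Dense (S.domain : Set F))
    (hdomC : ∀ y : G, y ∈ C.domain ↔ ∃ hy : y ∈ S†.domain, S† ⟨y, hy⟩ ∈ S.domain)
    (hvalC : ∀ (y : C.domain) (hy : (y : G) ∈ S†.domain) (hSy : S† ⟨y, hy⟩ ∈ S.domain),
      C y = S ⟨S† ⟨y, hy⟩, hSy⟩)
    (heig : ∀ i, ∃ h : (b i : G) ∈ C.domain, C ⟨b i, h⟩ = ((μ i : ℝ) : 𝕜) • (b i : G))
    (htend : Tendsto μ cofinite atTop)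
    (hdS' : Dense (S'.domain : Set F'))
    (hdomC' : ∀ y : G', y ∈ C'.domain ↔ ∃ hy : y ∈ S'†.domain, S'† ⟨y, hy⟩ ∈ S'.domain)
    (hvalC' : ∀ (y : C'.domain) (hy : (y : G') ∈ S'†.domain) (hSy : S'† ⟨y, hy⟩ ∈ S'.domain),
      C' y = S' ⟨S'† ⟨y, hy⟩, hSy⟩)
    (heig' : ∀ j, ∃ h : (b' j : G') ∈ C'.domain, C' ⟨b' j, h⟩ = ((μ' j : ℝ) : 𝕜) • (b' j : G'))
    (htend' : Tendsto μ' cofinite atTop)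
    (hgS : ∀ (u : F) (hu : u ∈ S.domain), ∃ h : g_F u ∈ S'.domain, S' ⟨g_F u, h⟩ = g_G (S ⟨u, hu⟩))
    (hkS : ∀ (u' : F') (hu' : u' ∈ S'.domain), ∃ h : k_F u' ∈ S.domain, S ⟨k_F u', h⟩ = k_G (S' ⟨u', hu'⟩))
    (hkg_G : ∀ z : G, k_G (g_G z) = z) (hgk_G : ∀ z' : G', g_G (k_G z') = z')
    {Mg Mk : ℝ} (hMg : 0 < Mg) (hMk : 0 < Mk) (hgF : ∀ y : F, ‖g_F y‖ ≤ Mg * ‖y‖)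
    (hgG : ∀ z : G, ‖g_G z‖ ≤ Mg * ‖z‖) (hkF : ∀ y' : F', ‖k_F y'‖ ≤ Mk * ‖y'‖)
    (hkG : ∀ z' : G', ‖k_G z'‖ ≤ Mk * ‖z'‖) (l : ℝ) :
    {i | μ i < l}.ncard ≤ {j | μ' j < (Mg * Mk) ^ 2 * l}.ncard ∧
      {j | μ' j < l}.ncard ≤ {i | μ i < (Mg * Mk) ^ 2 * l}.ncard := by
  refine ⟨ncard_eigenvalue_selfCompAdjoint_lt_le_of_map hdS hdomC hvalC heig htend hdS' hdomC' hvalC' heig' htend'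
    hkS hkg_G hMg hMk hgG hkF l, ?_⟩
  rw [mul_comm Mg Mk]
  exact ncard_eigenvalue_selfCompAdjoint_lt_le_of_map hdS' hdomC' hvalC' heig' htend' hdS hdomC hvalC heig htend
    hgS hgk_G hMk hMg hkG hgF l

end DegreeTwo

end Literature.Analysis.InnerProduct
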